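import Summits.QuantumFields.YangMills.Theorems.AllWindowsColdBoxBoxHighLineGaussianWeightTails
import Literature.MathematicalPhysics.QuantumFieldTheory.Balaban1983to89.B10Eq18ChangeOfVariables

/-!
# T-S5.4J, brick J3 (builder ym-line-fcl-p3 g25): CHANGE OF VARIABLES for a flat orbit-type map `f : (ι → ℝ) → (ι → ℝ)` —
# injectivity on a convex set from an ℓ²-CONTRACTION hypothesis of the J2 shape (run on `EuclideanSpace ℝ ι`, where the ℓ² bound IS the
# operator norm), the Jacobian substitution `∫_{f '' S} g = ∫_S |det Df|·g∘f` (Mathlib, Lebesgue on `ι → ℝ` is additive Haar), and the two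
# Gaussian evaluations the assembly of `OrbitNormaliserJacobian` needs on a GENERAL finite index type (`∫e^{−β|c|²} = √(π/β)^{|ι|}`, ball ≥ full − tail).

Serves LINE-19 S5 ⟨stmt-QuantumFields-24004⟩/⟨24335⟩ (T-S5.4J of `Cruxes/BoxWindowHighSU2213/TaskS5Laplace.lean`, planner ym-idea-2 g18); U5-window OPEN.
HONEST LABEL: an analytic brick; T-S5.4J, S5, U5 and the three items are OPEN; the Yang–Mills mass gap is NOT proved by this file; no summit is proved by a line.
-/

set_option autoImplicit false

noncomputable section

open MeasureTheory Matrix Real Set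
open Literature.MathematicalPhysics.QuantumFieldTheory.Balaban1983to89
open Literature.MathematicalPhysics.QuantumFieldTheory.Balaban1983to89.Beta

namespace Summit.QuantumFields.YangMills.Theorems.AllWindowsColdBoxBoxHighLine.OrbitJacobian

variable {ι : Type*} [Fintype ι] [DecidableEq ι]

/-! ## §1 Injectivity from an ℓ²-contraction (J2 shape), via the mean-value inequality on `EuclideanSpace ℝ ι` -/

omit [DecidableEq ι] in
/-- The Euclidean norm of `toLp 2 u` is `√(u ⬝ᵥ u)`: `‖(EuclideanSpace.equiv ι ℝ).symm u‖² = u ⬝ᵥ u`. [folklore] -/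
theorem norm_equiv_symm_sq (u : ι → ℝ) : ‖(EuclideanSpace.equiv ι ℝ).symm u‖ ^ 2 = u ⬝ᵥ u := by
  rw [EuclideanSpace.norm_eq, Real.sq_sqrt (Finset.sum_nonneg fun i _ => sq_nonneg _)]
  simp [dotProduct, sq]

/-- ★ **Injectivity from the J2-contraction.**  Let `S ⊆ ℝ^ι` be convex, `f` differentiable on `S` (derivative `f' v` at `v ∈ S`, within `S`),
`F` an invertible matrix and `0 ≤ K < 1` with `|w − F⁻¹·(f' v) w|₂² ≤ K²|w|₂²` for all `v ∈ S` and all `w`.  Then `f` is injective on `S`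
(the map `G = F⁻¹∘f` has `‖1 − DG‖_{ℓ²→ℓ²} ≤ K < 1`; mean value inequality in `EuclideanSpace ℝ ι` via ✓`injOn_id_sub_of_nnnorm_fderiv_le`). [folklore] -/
theorem injOn_of_contraction {f : (ι → ℝ) → (ι → ℝ)} {f' : (ι → ℝ) → ((ι → ℝ) →L[ℝ] (ι → ℝ))} {S : Set (ι → ℝ)}
    (hS : Convex ℝ S) (hf : ∀ v ∈ S, HasFDerivWithinAt f (f' v) S v) {F : Matrix ι ι ℝ} (hF : IsUnit F.det)
    {K : NNReal} (hK : K < 1)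
    (hcontr : ∀ v ∈ S, ∀ w : ι → ℝ,
      (w - F⁻¹ *ᵥ (f' v w)) ⬝ᵥ (w - F⁻¹ *ᵥ (f' v w)) ≤ (K : ℝ) ^ 2 * (w ⬝ᵥ w)) :
    InjOn f S := by
  -- the flat inverse as a continuous linear map, and the Euclidean transport
  set e : EuclideanSpace ℝ ι ≃L[ℝ] (ι → ℝ) := EuclideanSpace.equiv ι ℝ with he
  set T : (ι → ℝ) →L[ℝ] (ι → ℝ) := LinearMap.toContinuousLinearMap (Matrix.toLin' F⁻¹) with hT
  have hT' : ∀ u, T u = F⁻¹ *ᵥ u := fun u => by simp [hT, Matrix.toLin'_apply]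
  -- `G = e⁻¹ ∘ F⁻¹ ∘ f ∘ e` on `Sᴱ = e ⁻¹' S`, and `𝒟 = id − G`
  set SE : Set (EuclideanSpace ℝ ι) := e ⁻¹' S with hSE
  have hSEconv : Convex ℝ SE := hS.linear_preimage e.toLinearEquiv.toLinearMap
  set G : EuclideanSpace ℝ ι → EuclideanSpace ℝ ι := fun x => e.symm (T (f (e x))) with hG
  set L : EuclideanSpace ℝ ι → (EuclideanSpace ℝ ι →L[ℝ] EuclideanSpace ℝ ι) :=
    fun x => (e.symm : (ι → ℝ) →L[ℝ] EuclideanSpace ℝ ι) ∘L (T ∘L ((f' (e x)) ∘L (e : EuclideanSpace ℝ ι →L[ℝ] (ι → ℝ)))) with hL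
  have hGderiv : ∀ x ∈ SE, HasFDerivWithinAt G (L x) SE x := by
    intro x hx
    have h1 : HasFDerivWithinAt (fun y : EuclideanSpace ℝ ι => e y) (e : EuclideanSpace ℝ ι →L[ℝ] (ι → ℝ)) SE x :=
      e.hasFDerivAt.hasFDerivWithinAt
    have h2 : HasFDerivWithinAt f (f' (e x)) S (e x) := hf (e x) hx
    have h3 : HasFDerivWithinAt (fun y : EuclideanSpace ℝ ι => f (e y)) ((f' (e x)) ∘L (e : EuclideanSpace ℝ ι →L[ℝ] (ι → ℝ))) SE x :=
      h2.comp x h1 (fun y hy => hy)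
    have h4 := (T.hasFDerivAt.comp_hasFDerivWithinAt x h3)
    have h5 := ((e.symm : (ι → ℝ) →L[ℝ] EuclideanSpace ℝ ι).hasFDerivAt).comp_hasFDerivWithinAt x h4
    exact h5
  -- the derivative of `𝒟 = id − G` is `1 − L x`, of norm ≤ K
  have hDderiv : ∀ x ∈ SE, HasFDerivWithinAt (fun y => y - G y) ((1 : EuclideanSpace ℝ ι →L[ℝ] EuclideanSpace ℝ ι) - L x) SE x :=
    fun x hx => (hasFDerivWithinAt_id x SE).sub (hGderiv x hx)
  have hnorm : ∀ x ∈ SE, ‖(1 : EuclideanSpace ℝ ι →L[ℝ] EuclideanSpace ℝ ι) - L x‖₊ ≤ K := by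
    intro x hx
    rw [← NNReal.coe_le_coe, coe_nnnorm]
    refine ContinuousLinearMap.opNorm_le_bound _ K.coe_nonneg fun y => ?_
    have hy : ((1 : EuclideanSpace ℝ ι →L[ℝ] EuclideanSpace ℝ ι) - L x) y = e.symm (e y - F⁻¹ *ᵥ (f' (e x) (e y))) := by
      simp [hL, hT', map_sub]
    rw [hy]
    have h1 : ‖e.symm (e y - F⁻¹ *ᵥ (f' (e x) (e y)))‖ ^ 2 ≤ ((K : ℝ) * ‖y‖) ^ 2 := by
      rw [norm_equiv_symm_sq, mul_pow]
      have hyy : ‖y‖ ^ 2 = (e y) ⬝ᵥ (e y) := by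
        have := norm_equiv_symm_sq (ι := ι) (e y)
        rwa [ContinuousLinearEquiv.symm_apply_apply] at this
      rw [hyy]
      exact hcontr (e x) hx (e y)
    exact (abs_le_of_sq_le_sq' h1 (by positivity)).2
  -- injectivity of `G` on `SE`
  have hGinj : InjOn G SE := by
    have h := B10Eq18ChangeOfVariables.injOn_id_sub_of_nnnorm_fderiv_le (𝒟 := fun y => y - G y) hSEconv hDderiv hnorm hK
    intro x hx y hy hxy
    exact h hx hy (by simp only [sub_sub_cancel]; exact hxy)
  -- back to `f`
  intro v hv w hw hfw
  have hFu : IsUnit F := (Matrix.isUnit_iff_isUnit_det F).2 hF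
  have hv' : e.symm v ∈ SE := by simp [hSE, hv]
  have hw' : e.symm w ∈ SE := by simp [hSE, hw]
  have hG' : G (e.symm v) = G (e.symm w) := by simp only [hG, ContinuousLinearEquiv.apply_symm_apply, hfw]
  have := hGinj hv' hw' hG'
  simpa using congrArg e this

/-! ## §2 The Jacobian substitution on `ι → ℝ` -/

omit [DecidableEq ι] in
/-- ★ **Change of variables** (Mathlib `integral_image_eq_integral_abs_det_fderiv_smul`, Lebesgue measure on `ι → ℝ` is additive Haar):
for measurable `S`, `f` differentiable on `S` within `S` and injective on `S`, and any `g`,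
`∫_{c ∈ f '' S} g c dc = ∫_{v ∈ S} |det (f' v)| · g (f v) dv`. [folklore] -/
theorem setIntegral_image_eq {f : (ι → ℝ) → (ι → ℝ)} {f' : (ι → ℝ) → ((ι → ℝ) →L[ℝ] (ι → ℝ))} {S : Set (ι → ℝ)}
    (hS : MeasurableSet S) (hf : ∀ v ∈ S, HasFDerivWithinAt f (f' v) S v) (hinj : InjOn f S) (g : (ι → ℝ) → ℝ) :
    ∫ c in f '' S, g c = ∫ v in S, |(f' v).det| * g (f v) := by
  have h := integral_image_eq_integral_abs_det_fderiv_smul (volume : Measure (ι → ℝ)) hS hf hinj g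
  simpa only [smul_eq_mul] using h

/-! ## §3 Gaussian evaluations on a general finite index type -/

/-- `−½ vᵀ((2β)·1)v = −β |v|²`. [folklore] -/
theorem neg_half_quadForm_smul_one (β : ℝ) (v : ι → ℝ) :
    -(1/2 : ℝ) * (v ⬝ᵥ ((2 * β) • (1 : Matrix ι ι ℝ)) *ᵥ v) = -(β * (v ⬝ᵥ v)) := by
  rw [Matrix.smul_mulVec, Matrix.one_mulVec, dotProduct_smul, smul_eq_mul]; ring

omit [Fintype ι] in
/-- `(2β)·1` is positive definite for `β > 0`. [folklore] -/
theorem posDef_smul_one {β : ℝ} (hβ : 0 < β) : ((2 * β) • (1 : Matrix ι ι ℝ)).PosDef :=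
  Matrix.PosDef.one.smul (by positivity)

/-- ★ `∫ e^{−β|v|²} dv = √(π/β)^{|ι|}` on `ι → ℝ` (`β > 0`). [folklore] -/
theorem integral_exp_neg_mul_dotProduct_self {β : ℝ} (hβ : 0 < β) :
    ∫ v : ι → ℝ, Real.exp (-(β * (v ⬝ᵥ v))) = Real.sqrt (Real.pi / β) ^ Fintype.card ι := by
  have h := GaussianIntegral.integral_exp_neg_half_quadForm _ (posDef_smul_one (ι := ι) hβ)
  simp_rw [neg_half_quadForm_smul_one] at h
  rw [h, LaplaceSandwich.mass_smul (1 : Matrix ι ι ℝ) (by positivity : (0 : ℝ) < 2 * β), Matrix.det_one, Real.sqrt_one, div_one,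
    ← div_pow]
  congr 1
  rw [div_eq_iff (Real.sqrt_pos.2 (by positivity)).ne', ← Real.sqrt_mul (div_pos Real.pi_pos hβ).le]
  congr 1
  field_simp

/-- Integrability of `e^{−β|v|²}`. [folklore] -/
theorem integrable_exp_neg_mul_dotProduct_self {β : ℝ} (hβ : 0 < β) :
    Integrable fun v : ι → ℝ => Real.exp (-(β * (v ⬝ᵥ v))) := by
  have h := GaussianIntegral.integrable_exp_neg_half_quadForm _ (posDef_smul_one (ι := ι) hβ)
  simp_rw [neg_half_quadForm_smul_one] at h
  exact h

/-- ★ **Relative norm tail** (4m shape, general `ι`): `∫_{ρ² < |v|²} e^{−β|v|²} ≤ e^{−βρ²/2}·√(2π/β)^{|ι|}`. [folklore] -/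
theorem setIntegral_exp_neg_mul_dotProduct_self_tail_le {β : ℝ} (hβ : 0 < β) (ρ : ℝ) :
    ∫ v in {v : ι → ℝ | ρ ^ 2 < v ⬝ᵥ v}, Real.exp (-(β * (v ⬝ᵥ v))) ≤
      Real.exp (-(β * ρ ^ 2 / 2)) * Real.sqrt (2 * Real.pi / β) ^ Fintype.card ι := by
  have hβ2 : 0 < β / 2 := by positivity
  set S : Set (ι → ℝ) := {v | ρ ^ 2 < v ⬝ᵥ v} with hS
  have hSm : MeasurableSet S :=
    measurableSet_lt measurable_const (continuous_id.dotProduct continuous_id).measurable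
  have hfi := integrable_exp_neg_mul_dotProduct_self (ι := ι) hβ
  have hgi := integrable_exp_neg_mul_dotProduct_self (ι := ι) hβ2
  have hpt : ∀ v ∈ S, Real.exp (-(β * (v ⬝ᵥ v))) ≤ Real.exp (-(β * ρ ^ 2 / 2)) * Real.exp (-(β / 2 * (v ⬝ᵥ v))) := by
    intro v hv
    have hv' : ρ ^ 2 < v ⬝ᵥ v := hv
    rw [← Real.exp_add]
    exact Real.exp_le_exp.2 (by nlinarith)
  calc ∫ v in S, Real.exp (-(β * (v ⬝ᵥ v)))
      ≤ ∫ v in S, Real.exp (-(β * ρ ^ 2 / 2)) * Real.exp (-(β / 2 * (v ⬝ᵥ v))) :=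
        setIntegral_mono_on hfi.integrableOn (hgi.const_mul _).integrableOn hSm hpt
    _ = Real.exp (-(β * ρ ^ 2 / 2)) * ∫ v in S, Real.exp (-(β / 2 * (v ⬝ᵥ v))) := integral_const_mul _ _
    _ ≤ Real.exp (-(β * ρ ^ 2 / 2)) * ∫ v, Real.exp (-(β / 2 * (v ⬝ᵥ v))) :=
        mul_le_mul_of_nonneg_left (setIntegral_le_integral hgi (ae_of_all _ fun v => (Real.exp_pos _).le)) (Real.exp_pos _).le
    _ = Real.exp (-(β * ρ ^ 2 / 2)) * Real.sqrt (2 * Real.pi / β) ^ Fintype.card ι := by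
        rw [integral_exp_neg_mul_dotProduct_self hβ2, div_div_eq_mul_div, mul_comm Real.pi 2]

/-- ★ **Gaussian mass of a centred ball from below**: `√(π/β)^{|ι|} − e^{−βρ²/2}·√(2π/β)^{|ι|} ≤ ∫_{|v|² ≤ ρ²} e^{−β|v|²}`. [folklore] -/
theorem setIntegral_exp_neg_mul_dotProduct_self_ball_ge {β : ℝ} (hβ : 0 < β) (ρ : ℝ) :
    Real.sqrt (Real.pi / β) ^ Fintype.card ι - Real.exp (-(β * ρ ^ 2 / 2)) * Real.sqrt (2 * Real.pi / β) ^ Fintype.card ι ≤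
      ∫ v in {v : ι → ℝ | v ⬝ᵥ v ≤ ρ ^ 2}, Real.exp (-(β * (v ⬝ᵥ v))) := by
  have hfi := integrable_exp_neg_mul_dotProduct_self (ι := ι) hβ
  have hBm : MeasurableSet {v : ι → ℝ | v ⬝ᵥ v ≤ ρ ^ 2} :=
    measurableSet_le (continuous_id.dotProduct continuous_id).measurable measurable_const
  have hcompl : {v : ι → ℝ | v ⬝ᵥ v ≤ ρ ^ 2}ᶜ = {v : ι → ℝ | ρ ^ 2 < v ⬝ᵥ v} := by ext v; simp [not_le]
  have hsplit := integral_add_compl hBm hfi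
  rw [hcompl, integral_exp_neg_mul_dotProduct_self hβ] at hsplit
  have htail := setIntegral_exp_neg_mul_dotProduct_self_tail_le (ι := ι) hβ ρ
  linarith

/-- Monotonicity in the domain for the Gaussian: `T ⊆ T'` ⇒ `∫_T e^{−β|v|²} ≤ ∫_{T'} e^{−β|v|²}`, and `∫_{T'} ≤ √(π/β)^{|ι|}`. [folklore] -/
theorem setIntegral_exp_neg_mul_dotProduct_self_mono {β : ℝ} (hβ : 0 < β) {T T' : Set (ι → ℝ)} (hTT' : T ⊆ T') :
    ∫ v in T, Real.exp (-(β * (v ⬝ᵥ v))) ≤ ∫ v in T', Real.exp (-(β * (v ⬝ᵥ v))) ∧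
      ∫ v in T', Real.exp (-(β * (v ⬝ᵥ v))) ≤ Real.sqrt (Real.pi / β) ^ Fintype.card ι := by
  have hfi := integrable_exp_neg_mul_dotProduct_self (ι := ι) hβ
  refine ⟨setIntegral_mono_set hfi.integrableOn (ae_of_all _ fun v => (Real.exp_pos _).le) (ae_of_all _ hTT'), ?_⟩
  rw [← integral_exp_neg_mul_dotProduct_self hβ]
  exact setIntegral_le_integral hfi (ae_of_all _ fun v => (Real.exp_pos _).le)

end Summit.QuantumFields.YangMills.Theorems.AllWindowsColdBoxBoxHighLine.OrbitJacobian

end
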